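/-
Origin: expansion seat `planner-pub-hodgecm-pv04-g4-0`, handover 2026-08-18T05:46:35Z (`HOME/pub-hodgecm-pv04-g4/lean/Pv04g4/ThetaSubIsogeny.lean`, md5 bf139ca6, 181 lines);
landed by the gen-6 packager in gate run 23 as `HodgeCM/PerL34/ThetaSubIsogeny.lean` (verbatim).
-/
/-
Copyright: pub-hodgecm formalisation cell (harness21, 2026). New file (not vendored).
Origin: HOME/pub-hodgecm-pv04-g4/lean/Pv04g4/ThetaSubIsogeny.lean — session planner-pub-hodgecm-pv04-g4-0 (unit
pub-hodgecm-pv04-g4), DAG-node prover #04, generation 4 (lineage pv04 → pv04-g2 → pv04-g3 → pv04-g4; seam S6 = node N12a).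
WIP module `Pv04g4.ThetaSubIsogeny`; intended final place `HodgeCM/PerL34/ThetaSubIsogeny.lean` (module
`HodgeCM.PerL34.ThetaSubIsogeny`; kind L5 — ONE NEW ADDITIVE FILE, no landed file is touched).  Depends only on the landed
`HodgeCM.PerL34.ThetaSubOfLiu` (gate run 22).
-/
import Summits.HodgeConjecture.HodgeCM.PerL34.ThetaSubOfLiu_2

/-!
# Seam S6, dictionary entry R4 made KERNEL: isogeny invariance of the `U_Θ(Γ)`-spans

The [Liu21] interface fact `ThetaModel.Fact_thetaAlbanese` (landed, `HodgeCM/PerL34/ThetaSubOfLiu.lean`) reads Liu's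
Prop 4.13 + Thm 4.18(1) through a four-entry dictionary R1–R4 recorded in its docstring.  Entry **R4 (reference variety)**
contains, besides its PRINT part (Shimura 1998 §6.1 THEOREM 2 COROLLARY + REMARK, p0053 L8/L12: two abelian varieties of the
same CM type are isogenous, compatibly with the CM), ONE INFERENCE stated in words: "an isogeny does not change the set of
pull-backs `F^*α` (M1)".  This file types and PROVES that inference, so that after it every inference of seam S6 is KERNEL
and R4 is reduced to its print part:

* `Universe.pullC_mem_Uiso_of_isogeny` — if `w : B → A_{(M,Θ)}` induces a BIJECTION on rational `H¹` intertwining an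
  `M`-action `ιB` on `H¹(B, ℚ)` with the CM action of the reference variety (this is all we use of "`M`-equivariant
  isogeny"), then for every `σ' ∈ Θ`, every `σ'`-eigenclass `β ∈ H¹(B, ℂ)` of `ιB` and every morphism `f : P_Γ → B`, the
  pull-back `f^*β` lies in `U_{(M,Θ,σ')}(Γ)`.  Inputs: M2 `Fact_pull_comp`, M13 `Fact_alphaLine` (numbering of the
  `ModelAxioms` fields as in `ThetaSubOfLiu.lean`; FACTS.md §1: M1 resp. M12).  Proof: `β = w^*α` with `α` the unique
  preimage; `α` is `σ'`-eigen by injectivity of `w^*` and the intertwining; `σ' ∈ Θ` makes the whole eigenline holomorphic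
  (M13), and `f^*w^*α = (w ∘ f)^*α` (M2).
* `ThetaModel.Fact_thetaAlbaneseIso` — the SAME [Liu21] interface, but with Liu's OWN CM abelian variety in the statement:
  the theta forms of type `Ψᵢ` at level `Γ` are pull-backs of `σ'`-eigen one-classes of SOME variety `B` carrying an
  `M`-action on `H¹` and an `H¹`-bijective `M`-intertwining morphism to the reference variety `A_{(M, Ψᵢ^M)}` (in the intended
  model: `B = A_μ ⊗_{E'} ℂ` of [Liu21] Def 4.5(1)/Thm 4.18(1), `w` = an `M_μ`-isogeny to the reference variety, which EXISTS by
  Shimura 1998 §6.1 Thm 2 Cor. + Remark — PRINT).  Holomorphy of `β` need not be assumed: `σ' ∘ k = σ ∈ Ψᵢ` (`GoodCtx.mem`)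
  gives `σ' ∈ Ψᵢ^M`, where the eigenline IS the holomorphic line (M13).
* `ThetaModel.fact_thetaAlbanese_of_iso` (M2, M13) and `ThetaModel.fact_thetaAlbaneseIso_of` (M1 `Fact_pull_id`):
  the two interface facts are EQUIVALENT over the model axioms — so this is bookkeeping of WHERE the isogeny step sits
  (kernel, not docstring), not a change of strength; seam S6 stays CONSERVATIVE (`fact_thetaAlbanese_of_open`).
* `ThetaModel.open_thetaSub_of_iso` — `Open_thetaSub` (= carver node `N12a_thetaSub` by `rfl`) from M2, M13, M38
  `Fact_cmInflation` and `Fact_thetaAlbaneseIso`; `fact_thetaAlbaneseIso_of_open` — and back (M1).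

No new constant, no axiom, no proof placeholder; nothing here is cited as a fact — the PRINT content is unchanged ([Liu21] 4.13 +
4.18(1); Shimura 1998 §6.1 Thm 2 Cor., §6.2 Thm 3) and lives in the docstrings of `ThetaSubOfLiu.lean`.
-/

noncomputable section

open scoped TensorProduct

namespace HodgeCM

open Literature.AlgebraicGeometry.Motives (CMType)
open CMTypeOps (inflate)

namespace Universe

variable {U : Universe}

/-! ### KERNEL: a bijective rational map stays bijective after `⊗ ℂ` -/

omit U in
/-- (Ported verbatim from the HodgeCMPerL package; no docstring in the source.) -/
theorem baseChange_bijective_of_bijective {V W : Type*} [AddCommGroup V] [Module ℚ V] [AddCommGroup W] [Module ℚ W]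
    (f : V →ₗ[ℚ] W) (hf : Function.Bijective f) : Function.Bijective (f.baseChange ℂ) := by
  have h : f.baseChange ℂ = ((LinearEquiv.ofBijective f hf).baseChange ℚ ℂ V W : ℂ ⊗[ℚ] V →ₗ[ℂ] ℂ ⊗[ℚ] W) := by
    ext x
    simp [LinearEquiv.baseChange]
  rw [h]
  exact ((LinearEquiv.ofBijective f hf).baseChange ℚ ℂ V W).bijective

/-! ### KERNEL: isogeny invariance of `U_Θ(Γ)` (dictionary R4) -/

/-- **Isogeny invariance of the `U_Θ`-spans.**  Let `w : B → A_{(M,Θ)}` induce a bijection on rational `H¹` which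
intertwines an `M`-action `ιB` on `H¹(B, ℚ)` with the CM action of the reference variety.  Then for `σ' ∈ Θ`, every
`σ'`-eigenclass `β` of `ιB` on `H¹(B, ℂ)`, pulled back along any `f : P_Γ → B`, lies in `U_{(M,Θ,σ')}(Γ)`. -/
theorem pullC_mem_Uiso_of_isogeny (h2 : U.Fact_pull_comp) (h13 : U.Fact_alphaLine)
    {L : CMField} {ι₁ : L →+* ℂ} {V : HermSpace3 L ι₁} (Γ : Level V)
    (M : CMField) (Θ : CMType M) (σ' : M →+* ℂ) (hσ : σ' ∈ Θ.1)
    {B : U.Var} (ιB : M → Module.End ℚ (U.Coh B 1)) (w : U.Mor B (U.cmAV M Θ))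
    (hw : Function.Bijective (U.pull w 1))
    (hwe : ∀ a : M, U.pull w 1 ∘ₗ (U.cmAct M Θ).ι a = ιB a ∘ₗ U.pull w 1)
    (β : U.CohC B 1) (hβ : ∀ a : M, (ιB a).baseChange ℂ β = σ' a • β)
    (f : U.Mor (U.pms L ι₁ V Γ) B) :
    U.pullC f 1 β ∈ U.Uiso Γ M Θ σ' := by
  have hbC : Function.Bijective (U.pullC w 1) := baseChange_bijective_of_bijective _ hw
  obtain ⟨α, rfl⟩ := hbC.2 β
  have hαe : α ∈ U.eigenLine M Θ σ' := by
    rw [mem_eigenLine_iff]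
    intro a
    apply hbC.1
    have hcomm : U.pullC w 1 (((U.cmAct M Θ).ι a).baseChange ℂ α) = (ιB a).baseChange ℂ (U.pullC w 1 α) := by
      change ((U.pull w 1).baseChange ℂ ∘ₗ ((U.cmAct M Θ).ι a).baseChange ℂ) α =
        ((ιB a).baseChange ℂ ∘ₗ (U.pull w 1).baseChange ℂ) α
      rw [← LinearMap.baseChange_comp, ← LinearMap.baseChange_comp, hwe a]
    rw [hcomm, hβ a, map_smul]
  have hα : α ∈ U.alphaLine M Θ σ' := by
    rw [(h13 M Θ σ').1 hσ]
    exact hαe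
  rw [← pullC_comp_apply h2 f w 1 α]
  exact Submodule.subset_span ⟨U.comp f w, α, hα, rfl⟩

/-- Span form: the span of all such pull-backs `f^*β` is contained in `U_{(M,Θ,σ')}(Γ)`. -/
theorem span_pullC_le_Uiso_of_isogeny (h2 : U.Fact_pull_comp) (h13 : U.Fact_alphaLine)
    {L : CMField} {ι₁ : L →+* ℂ} {V : HermSpace3 L ι₁} (Γ : Level V)
    (M : CMField) (Θ : CMType M) (σ' : M →+* ℂ) (hσ : σ' ∈ Θ.1)
    {B : U.Var} (ιB : M → Module.End ℚ (U.Coh B 1)) (w : U.Mor B (U.cmAV M Θ))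
    (hw : Function.Bijective (U.pull w 1))
    (hwe : ∀ a : M, U.pull w 1 ∘ₗ (U.cmAct M Θ).ι a = ιB a ∘ₗ U.pull w 1) :
    Submodule.span ℂ {ω | ∃ (f : U.Mor (U.pms L ι₁ V Γ) B) (β : U.CohC B 1),
        (∀ a : M, (ιB a).baseChange ℂ β = σ' a • β) ∧ ω = U.pullC f 1 β} ≤ U.Uiso Γ M Θ σ' := by
  refine Submodule.span_le.2 ?_
  rintro ω ⟨f, β, hβ, rfl⟩
  exact U.pullC_mem_Uiso_of_isogeny h2 h13 Γ M Θ σ' hσ ιB w hw hwe β hβ f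

namespace ThetaModel

variable (T : U.ThetaModel)

/-- **[Liu21] Prop 4.13 + Thm 4.18(1) with Liu's own CM abelian variety in the statement** (dictionary R1–R3 as in
`Fact_thetaAlbanese`; R4 replaced by the data `B, ιB, w`).  In a good seesaw context, for each type index `i` and level `Γ`:
there are a CM field `M`, `k : K →+* M`, `σ' : M →+* ℂ` with `σ' ∘ k = σ`, a variety `B` with an `M`-action `ιB` on
`H¹(B, ℚ)` and a morphism `w : B → A_{(M, Ψᵢ^M)}` inducing an `M`-intertwining BIJECTION on rational `H¹` (read: `B = A_μ ⊗ ℂ`,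
`w` an `M_μ`-isogeny to the reference variety — Shimura 1998 §6.1 Thm 2 Cor. + Remark, p0053 L8/L12), such that every theta
one-form of type `Ψᵢ` at level `Γ` is a finite sum of pull-backs `f^*β` (`f : P_Γ → B`) of `σ'`-eigenclasses `β ∈ H¹(B, ℂ)`
([Liu21] Thm 4.18(1): `θ = f^*α`, `α` a basis of the line of `H¹_{B,τ'}(A_μ, ℂ)` on which `M_μ` acts through the inclusion). -/
def Fact_thetaAlbaneseIso : Prop :=
  ∀ {L : CMField} {ι₁ : L →+* ℂ} (V : HermSpace3 L ι₁) (c : SeesawCtx L), T.GoodCtx ι₁ c →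
    ∀ (i : Fin 4) (Γ : Level V), ∃ (M : CMField) (k : c.K →+* M) (σ' : M →+* ℂ), σ'.comp k = c.σ ∧
      ∃ (B : U.Var) (ιB : M → Module.End ℚ (U.Coh B 1)) (w : U.Mor B (U.cmAV M (inflate k (c.Ψ i)))),
        Function.Bijective (U.pull w 1) ∧
        (∀ a : M, U.pull w 1 ∘ₗ (U.cmAct M (inflate k (c.Ψ i))).ι a = ιB a ∘ₗ U.pull w 1) ∧
        T.Theta V c i Γ ⊆ Submodule.span ℂ {ω | ∃ (f : U.Mor (U.pms L ι₁ V Γ) B) (β : U.CohC B 1),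
          (∀ a : M, (ιB a).baseChange ℂ β = σ' a • β) ∧ ω = U.pullC f 1 β}

/-- **R4 discharged in the kernel**: the isogeny form implies the reference-variety form (M2, M13). -/
theorem fact_thetaAlbanese_of_iso (h2 : U.Fact_pull_comp) (h13 : U.Fact_alphaLine)
    (h : T.Fact_thetaAlbaneseIso) : T.Fact_thetaAlbanese := by
  intro L ι₁ V c hc i Γ
  obtain ⟨M, k, σ', hσ, B, ιB, w, hw, hwe, hsub⟩ := h V c hc i Γ
  refine ⟨M, k, σ', hσ, ?_⟩
  have hmem : σ' ∈ (inflate k (c.Ψ i)).1 := by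
    rw [CMTypeOps.mem_inflate_iff, hσ]
    exact hc.mem i
  exact hsub.trans (U.span_pullC_le_Uiso_of_isogeny h2 h13 Γ M _ σ' hmem ιB w hw hwe)

/-- Conversely the reference-variety form gives the isogeny form with `B` the reference variety itself, `w = id`
(M1 `Fact_pull_id`): the two interfaces are equivalent over the model axioms (no change of strength). -/
theorem fact_thetaAlbaneseIso_of (h1 : U.Fact_pull_id) (h : T.Fact_thetaAlbanese) : T.Fact_thetaAlbaneseIso := by
  intro L ι₁ V c hc i Γ
  obtain ⟨M, k, σ', hσ, hsub⟩ := h V c hc i Γ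
  refine ⟨M, k, σ', hσ, U.cmAV M (inflate k (c.Ψ i)), fun a => (U.cmAct M (inflate k (c.Ψ i))).ι a,
    U.idMor _, ?_, ?_, ?_⟩
  · rw [h1]
    exact Function.bijective_id
  · intro a
    rw [h1]
    rfl
  · refine hsub.trans (Submodule.span_mono ?_)
    rintro ω ⟨F, α, hα, rfl⟩
    exact ⟨F, α, fun a => (((U.cmAct M (inflate k (c.Ψ i))).mem_eigenPiece_iff σ' 1 0 α).1 hα).2 a, rfl⟩

/-- **Seam S6 / node N12a from the isogeny-form interface** (M1, M2, M13, M38 + [Liu21] read with Liu's `A_μ`). -/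
theorem open_thetaSub_of_iso (h2 : U.Fact_pull_comp) (h13 : U.Fact_alphaLine)
    (h38 : U.Fact_cmInflation) (h : T.Fact_thetaAlbaneseIso) : T.Open_thetaSub :=
  T.open_thetaSub_of_liu h2 h13 h38 (T.fact_thetaAlbanese_of_iso h2 h13 h)

/-- `ModelAxioms` form (CONTRIBUTING §3 L2 shape). -/
theorem open_thetaSub_of_iso_split (A : U.ModelAxioms) :
    U.Fact_cmInflation → T.Fact_thetaAlbaneseIso → T.Open_thetaSub :=
  T.open_thetaSub_of_iso A.pull_comp A.alphaLine

/-- Honest strength note (as for `Fact_thetaAlbanese`): `Open_thetaSub` gives the isogeny-form interface back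
(M1), so over the model axioms + M38 all three of `Open_thetaSub`, `Fact_thetaAlbanese`, `Fact_thetaAlbaneseIso` are
equivalent — the seam stays CONSERVATIVE. -/
theorem fact_thetaAlbaneseIso_of_open (h1 : U.Fact_pull_id) (h : T.Open_thetaSub) : T.Fact_thetaAlbaneseIso :=
  T.fact_thetaAlbaneseIso_of h1 (T.fact_thetaAlbanese_of_open h)

end ThetaModel

end Universe

end HodgeCM

end
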